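import Summits.NavierStokesRegularity.NavierStokesRegularity.Theorems.PerpetualPumpAveragedTypeIBlowupStepExistsTools

/-!
# Crux `PerpetualPump.AveragedTypeIBlowup` (stmt-NavierStokesRegularity-1835), line `Sketch`:
# the stub `stepExists` — a solution of the chain lives beyond a certified next hand-off

T. Tao, *Finite time blowup for an averaged three-dimensional Navier–Stokes equation*, J. Amer.
Math. Soc. **29** (2016), 601–674 = arXiv:1402.0290v3, §4 p. 22 (4.14), §5–§6: the wavelet
coefficients of a mild solution of the cascade equation solve the exact Volterra chain
`Y_{i,n}(t) = A 1_{(i,n)=(0,0)} k_{i,n}(t) + ∫₀ᵗ k_{i,n}(t-s) quadTerm(Y)_{i,n}(s) ds`, and the blowup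
is driven step by step along a staircase of hand-off times.

This file proves the registered stub `stub_stepExists` of the lead's skeleton
`Cruxes/AveragedTypeIBlowup/Lines/Sketch.lean`, verbatim (let-free tree vocabulary: the structure
constants `α`, kernels `kern`, observables `bvo, wvo`, kernel majorants `M0o, M1o`, `q`, rates `R`,
ladder `lad`, the solution class `Sol`, the hand-off invariant `Invo` and the tube `Tubeo` are bound
variables pinned by defining equations, and the abstract WINDOW ONE-STEP THEOREM is a hypothesis).

THE NEXT HAND-OFF EXISTS: if a solution `Y₀` on `[0,S₀)` from the datum `A` carries the hand-off
invariant `Invo A Y₀ n B t₀` at `t₀ < S₀` with `B ∈ [blo, bhi]`, then some solution from `A` (agreeing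
with `Y₀` on the common lifespan) lives beyond a certified next hand-off. The proof is a continuation
argument by contradiction. For ANY solution `Y` on `[0,S)` with `S > t₀` and any horizon
`T ∈ (t₀, S)`, the bridge package `stepExists_critical` (critical Toda system with memory errors,
majorants, far tail: `chainCritical_of_kernels`, `chainCriticalC1_of_kernels`, `stub_tailOfWeight`)
and the invariant at `t₀` — transferred from `Y₀` to `Y` by uniqueness of the chain (`chain_unique`)
and locality of the observables (`stepExists_inv_transfer`) — feed the one-step theorem. If no
solution admitted its hand-off branch, every solution with lifespan `> t₀` would take the a-priori
branch at every horizon: lifespan `≤ t₀ + 4/R n` and the tube after `t₀`; the tube and the class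
bound before `t₀` give the `(1+ε₀)^{10n}` a-priori bound (`stepExists_apriori`), so the continuation
principle `stub_extendOfApriori` produces a solution living beyond `t₀ + 4/R n` — a contradiction.

Nothing here changes a statement of the route; the file lands with `--supports`.

## References

* T. Tao, J. Amer. Math. Soc. 29 (2016), 601–674, arXiv:1402.0290v3, §4 p. 22 (4.14), §5.
  [`Tao2016AveragedNS`]
-/

noncomputable section

-- the summit namespace `…NavierStokesRegularity.NavierStokesRegularity…` is the tree convention
set_option linter.dupNamespace false

open MeasureTheory Set Filter Topology
open scoped ENNReal
open Literature.Analysis.FluidPDE Literature.Analysis.FluidPDE.Tao2016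
open Literature.Analysis.FluidPDE.TaoCascade (quadTerm IsSymmetricCoeff IsCancellingCoeff)

namespace Summit.NavierStokesRegularity.NavierStokesRegularity.Theorems.PerpetualPumpAveragedTypeIBlowup

/-! ### The registered stub -/

/-- **Stub `stepExists`** (registered stub of the line `Sketch` of the crux
`PerpetualPump.AveragedTypeIBlowup`, verbatim; consumes the window one-step theorem as a hypothesis).
THE NEXT HAND-OFF EXISTS: if a solution of the seeded-Toda chain from the datum `A` lives beyond `t₀`
and carries the hand-off invariant `Invo A Y₀ n B t₀` with `B ∈ [blo, bhi]`, then SOME solution from `A`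
(agreeing with it on the common lifespan) lives beyond a certified hand-off `t₁ ≤ t₀ + 4/R n` to the
front `n+1` — because either an extension reaches far enough for the one-step theorem to hand off, or
every extension stays inside the one-step's a-priori tube, is therefore `(1+ε₀)^{10n}`-bounded
(`stepExists_apriori`), and `stub_extendOfApriori` extends it beyond `t₀ + 4/R n`, where the a-priori
branch is impossible; the invariant transfers along extensions by uniqueness (`chain_unique`).
[cite: Tao2016AveragedNS, §4 p. 22 (4.14)] -/
theorem stub_stepExists :
    ∀ {ε₀ : ℝ}, 0 < ε₀ → ε₀ ≤ 1 / 20 → ∀ (𝒟 : CascadeWaveletData ε₀ 2) (r Dc εb : ℝ)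
      (α : Fin 2 → Fin 2 → Fin 2 → ℤ × ℤ × ℤ → ℝ) (kern : Fin 2 → ℤ → ℝ → ℝ)
      (bvo wvo : (Fin 2 → ℤ → ℝ → ℝ) → ℤ → ℝ → ℝ) (M0o M1o : ℝ → (Fin 2 → ℤ → ℝ → ℝ) → ℤ → ℝ → ℝ)
      (q : ℝ) (R : ℤ → ℝ) (lad : ℕ → ℝ) (Sol : ℝ → ℝ → (Fin 2 → ℤ → ℝ → ℝ) → Prop),
      0 < r → r ≤ (1 + ε₀ / 4) / 2 → (∀ i, 𝒟.radius i ≤ r ∧ ‖𝒟.center i‖ = 1 + ε₀ / 4) →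
      Dc = 4 * Real.pi ^ 2 * ((1 + ε₀ / 4) ^ 2 + r ^ 2) → 0 < εb →
      α = (fun (i₁ i₂ i₃ : Fin 2) (μ : ℤ × ℤ × ℤ) =>
          if i₁ = 1 ∧ i₂ = 1 ∧ i₃ = 0 ∧ μ = (0, 0, 0) then Dc else
          if i₁ = 1 ∧ i₂ = 0 ∧ i₃ = 1 ∧ μ = (0, 0, 0) then -Dc / 2 else
          if i₁ = 0 ∧ i₂ = 1 ∧ i₃ = 1 ∧ μ = (0, 0, 0) then -Dc / 2 else
          if i₁ = 1 ∧ i₂ = 0 ∧ i₃ = 1 ∧ μ = (0, 1, 0) then Dc / 2 else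
          if i₁ = 0 ∧ i₂ = 1 ∧ i₃ = 1 ∧ μ = (1, 0, 0) then Dc / 2 else
          if i₁ = 1 ∧ i₂ = 1 ∧ i₃ = 0 ∧ μ = (0, 0, 1) then -Dc else
          if i₁ = 0 ∧ i₂ = 0 ∧ i₃ = 1 ∧ μ = (0, 0, 0) then εb * Dc else
          if i₁ = 0 ∧ i₂ = 1 ∧ i₃ = 0 ∧ μ = (0, 0, 0) then -(εb * Dc) / 2 else
          if i₁ = 1 ∧ i₂ = 0 ∧ i₃ = 0 ∧ μ = (0, 0, 0) then -(εb * Dc) / 2 else 0) →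
      (∀ (i : Fin 2) (n : ℤ) (τ : ℝ),
        kern i n τ = (pairing (heat τ (cascadeWavelet ε₀ (𝒟.ψ i) n)) (cascadeWavelet ε₀ (𝒟.ψ i) n)).re) →
      (∀ (Y : Fin 2 → ℤ → ℝ → ℝ) (n : ℤ) (t : ℝ), bvo Y n t = -((1 + ε₀) ^ ((n : ℝ) / 2) * Y 0 n t)) →
      (∀ (Y : Fin 2 → ℤ → ℝ → ℝ) (n : ℤ) (t : ℝ), wvo Y n t = (1 + ε₀) ^ ((n : ℝ) / 2) * Y 1 n t) →
      (∀ (A : ℝ) (Y : Fin 2 → ℤ → ℝ → ℝ) (n : ℤ) (t : ℝ), M0o A Y n t = (1 + ε₀) ^ ((n : ℝ) / 2) *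
        ((if n = 0 then |A| else 0) * (∫ ξ, Real.exp (-(heatRate ξ * t)) * modeWeight 𝒟 0 n ξ) +
          ∫ s in (0 : ℝ)..t, (∫ ξ, Real.exp (-(heatRate ξ * (t - s))) * modeWeight 𝒟 0 n ξ) *
            |quadTerm ε₀ α Y 0 n s|)) →
      (∀ (A : ℝ) (Y : Fin 2 → ℤ → ℝ → ℝ) (n : ℤ) (t : ℝ), M1o A Y n t = (1 + ε₀) ^ ((n : ℝ) / 2) *
        ∫ s in (0 : ℝ)..t, (∫ ξ, Real.exp (-(heatRate ξ * (t - s))) * modeWeight 𝒟 1 n ξ) *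
          |quadTerm ε₀ α Y 1 n s|) →
      q = Real.sqrt (1 + ε₀) → (∀ k : ℤ, R k = Dc * (1 + ε₀) ^ (2 * k)) →
      (∀ j : ℕ, lad j = εb * ((1 + ε₀) ^ (19 * (j - 2)))⁻¹) →
      (∀ (A S : ℝ) (Y : Fin 2 → ℤ → ℝ → ℝ), Sol A S Y ↔
        (0 < S ∧ (∀ i n, ContinuousOn (Y i n) (Ico 0 S)) ∧ (∀ i n t, n < 0 → Y i n t = 0) ∧
        (∀ S' : ℝ, S' < S → ∃ C : ℝ, ∀ (i : Fin 2) (n : ℤ), ∀ t ∈ Icc 0 S',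
          (1 + ε₀) ^ ((20 : ℝ) * n) * |Y i n t| ≤ C) ∧
        (∀ (i : Fin 2) (n : ℤ), ∀ t ∈ Ico 0 S,
          Y i n t = (if i = 0 ∧ n = 0 then A else 0) * kern i n t +
            ∫ s in (0 : ℝ)..t, kern i n (t - s) * quadTerm ε₀ α Y i n s))) →
      ∀ (F bhi : ℝ) (Invo : ℝ → (Fin 2 → ℤ → ℝ → ℝ) → ℤ → ℝ → ℝ → Prop),
      (∀ (A : ℝ) (Y : Fin 2 → ℤ → ℝ → ℝ) (m : ℤ) (Bm t : ℝ), Invo A Y m Bm t ↔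
        (bvo Y m t = Bm ∧ (∀ s ∈ Icc 0 t, bvo Y m s ≤ Bm) ∧
        (0 ≤ wvo Y m t ∧ wvo Y m t ≤ F * εb * Bm ∧ M1o A Y m t ≤ F * εb * Bm ∧ M0o A Y m t ≤ 2 * Bm) ∧
        (0 ≤ m - 1 → 0 ≤ wvo Y (m - 1) t ∧ q ^ 3 * Bm - 1 ≤ (wvo Y (m - 1) t) ^ 2 ∧
          (wvo Y (m - 1) t) ^ 2 ≤ q ^ 3 * Bm + 1 ∧ 9 / 20 ≤ bvo Y (m - 1) t ∧ bvo Y (m - 1) t ≤ 11 / 20 ∧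
          M0o A Y (m - 1) t ≤ 5 * (bhi + 4) ^ 2 ∧ M1o A Y (m - 1) t ≤ 5 * (bhi + 4) ^ 2) ∧
        (|bvo Y (m + 1) t| ≤ εb ∧ |wvo Y (m + 1) t| ≤ εb ∧ M0o A Y (m + 1) t ≤ εb ∧ M1o A Y (m + 1) t ≤ εb) ∧
        (∀ j : ℕ, 2 ≤ j → |bvo Y (m + j) t| ≤ lad j ∧ |wvo Y (m + j) t| ≤ lad j / 5 ∧
          M0o A Y (m + j) t ≤ lad j ∧ M1o A Y (m + j) t ≤ lad j) ∧
        (∀ j : ℕ, 1 ≤ j → ∀ s ∈ Icc 0 t, bvo Y (m + j) s ≤ 1 / 2) ∧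
        (∀ k : ℤ, 0 ≤ k → k ≤ m - 2 → ∃ te ∈ Icc 0 t,
          (-(2 / 5) ≤ bvo Y k te ∧ bvo Y k te ≤ 3 / 10 ∧ |wvo Y k te| ≤ 1 / 200 ∧
            M0o A Y k te ≤ 10 * (bhi + 4) ^ 2 ∧ M1o A Y k te ≤ 10 * (bhi + 4) ^ 2) ∧
          ∀ s ∈ Icc te t, -(9 / 20) ≤ bvo Y k s ∧ bvo Y k s ≤ 7 / 20 ∧ |wvo Y k s| ≤ 1 / 100 ∧
            M0o A Y k s ≤ 10 * (bhi + 4) ^ 2 + 1 ∧ M1o A Y k s ≤ 10 * (bhi + 4) ^ 2 + 1 ∧ |wvo Y (k - 1) s| ≤ 1 / 100 ∧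
            -(1 / 2) ≤ bvo Y (k + 1) s ∧ bvo Y (k + 1) s ≤ 9 / 10))) →
      ∀ (Tubeo : ℝ → (Fin 2 → ℤ → ℝ → ℝ) → ℤ → ℝ → Prop),
      (∀ (A : ℝ) (Y : Fin 2 → ℤ → ℝ → ℝ) (m : ℤ) (t : ℝ), Tubeo A Y m t ↔
        ((∀ k : ℤ, k ≤ m + 1 → |bvo Y k t| ≤ 2 * (bhi + 3) ∧ |wvo Y k t| ≤ 2 * (bhi + 3) ∧
          M0o A Y k t ≤ 20 * (bhi + 4) ^ 2 ∧ M1o A Y k t ≤ 20 * (bhi + 4) ^ 2) ∧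
        (∀ j : ℕ, 2 ≤ j → |bvo Y (m + j) t| ≤ lad j ∧ |wvo Y (m + j) t| ≤ lad j ∧
          M0o A Y (m + j) t ≤ lad j ∧ M1o A Y (m + j) t ≤ lad j))) →
      ∀ (θ η blo : ℝ), θ = (1 + ε₀ / 4 - r) ^ 2 / ((1 + ε₀ / 4) ^ 2 + r ^ 2) →
      η = 2 * (1 + ε₀ / 4) * r / ((1 + ε₀ / 4) ^ 2 + r ^ 2) →
      εb ≤ 1 / 10 ^ 6 → 1 / 2 ≤ θ → θ ≤ 1 →
      10 ^ 4 + 40 - 5 * Real.log εb ≤ blo → 10 ^ 9 * (bhi + 4) ^ 4 ≤ F →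
      η * (10 ^ 9 * (bhi + 4) ^ 4 * (F + 1)) ≤ 1 → εb * (10 ^ 9 * (F + 1) ^ 2 * (bhi + 4) ^ 3) ≤ 1 →
      10 ^ 3 + 20 * Real.log (bhi + 5) + Real.log (F + 2) ≤ -Real.log εb →
      (∀ (ε₀ D εb θ η F blo bhi : ℝ) (n₀ : ℤ) (bv wv M0 M1 db dw : ℤ → ℝ → ℝ) (q : ℝ) (R : ℤ → ℝ) (lad : ℕ → ℝ)
      (G0 G1 : ℤ → ℝ → ℝ) (Inv : ℤ → ℝ → ℝ → Prop) (Tube : ℤ → ℝ → Prop) (n : ℤ) (B t₀ T : ℝ),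
      q = Real.sqrt (1 + ε₀) → (∀ k : ℤ, R k = D * (1 + ε₀) ^ (2 * k)) →
      (∀ j : ℕ, lad j = εb * ((1 + ε₀) ^ (19 * (j - 2)))⁻¹) →
      (∀ (k : ℤ) (t : ℝ), G0 k t = (wv (k - 1) t) ^ 2 / q ^ 3 - (wv k t) ^ 2 - εb * bv k t * wv k t) →
      (∀ (k : ℤ) (t : ℝ), G1 k t = wv k t * (bv k t - bv (k + 1) t / q) + εb * (bv k t) ^ 2) →
      (∀ (m : ℤ) (Bm t : ℝ), Inv m Bm t ↔
        (bv m t = Bm ∧ (∀ s ∈ Icc 0 t, bv m s ≤ Bm) ∧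
        (0 ≤ wv m t ∧ wv m t ≤ F * εb * Bm ∧ M1 m t ≤ F * εb * Bm ∧ M0 m t ≤ 2 * Bm) ∧
        (n₀ ≤ m - 1 → 0 ≤ wv (m - 1) t ∧ q ^ 3 * Bm - 1 ≤ (wv (m - 1) t) ^ 2 ∧
          (wv (m - 1) t) ^ 2 ≤ q ^ 3 * Bm + 1 ∧ 9 / 20 ≤ bv (m - 1) t ∧ bv (m - 1) t ≤ 11 / 20 ∧
          M0 (m - 1) t ≤ 5 * (bhi + 4) ^ 2 ∧ M1 (m - 1) t ≤ 5 * (bhi + 4) ^ 2) ∧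
        (|bv (m + 1) t| ≤ εb ∧ |wv (m + 1) t| ≤ εb ∧ M0 (m + 1) t ≤ εb ∧ M1 (m + 1) t ≤ εb) ∧
        (∀ j : ℕ, 2 ≤ j → |bv (m + j) t| ≤ lad j ∧ |wv (m + j) t| ≤ lad j / 5 ∧
          M0 (m + j) t ≤ lad j ∧ M1 (m + j) t ≤ lad j) ∧
        (∀ j : ℕ, 1 ≤ j → ∀ s ∈ Icc 0 t, bv (m + j) s ≤ 1 / 2) ∧
        (∀ k : ℤ, n₀ ≤ k → k ≤ m - 2 → ∃ te ∈ Icc 0 t,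
          (-(2 / 5) ≤ bv k te ∧ bv k te ≤ 3 / 10 ∧ |wv k te| ≤ 1 / 200 ∧
            M0 k te ≤ 10 * (bhi + 4) ^ 2 ∧ M1 k te ≤ 10 * (bhi + 4) ^ 2) ∧
          ∀ s ∈ Icc te t, -(9 / 20) ≤ bv k s ∧ bv k s ≤ 7 / 20 ∧ |wv k s| ≤ 1 / 100 ∧
            M0 k s ≤ 10 * (bhi + 4) ^ 2 + 1 ∧ M1 k s ≤ 10 * (bhi + 4) ^ 2 + 1 ∧ |wv (k - 1) s| ≤ 1 / 100 ∧
            -(1 / 2) ≤ bv (k + 1) s ∧ bv (k + 1) s ≤ 9 / 10))) →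
      (∀ (m : ℤ) (t : ℝ), Tube m t ↔
        ((∀ k : ℤ, k ≤ m + 1 → |bv k t| ≤ 2 * (bhi + 3) ∧ |wv k t| ≤ 2 * (bhi + 3) ∧
          M0 k t ≤ 20 * (bhi + 4) ^ 2 ∧ M1 k t ≤ 20 * (bhi + 4) ^ 2) ∧
        (∀ j : ℕ, 2 ≤ j → |bv (m + j) t| ≤ lad j ∧ |wv (m + j) t| ≤ lad j ∧
          M0 (m + j) t ≤ lad j ∧ M1 (m + j) t ≤ lad j))) →
      -- regime
      0 < ε₀ → ε₀ ≤ 1 / 20 → 0 < D → 1 / 2 ≤ θ → θ ≤ 1 → 0 ≤ η → 0 < εb → εb ≤ 1 / 10 ^ 6 →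
      10 ^ 4 + 40 - 5 * Real.log εb ≤ blo → 10 ^ 9 * (bhi + 4) ^ 4 ≤ F →
      η * (10 ^ 9 * (bhi + 4) ^ 4 * (F + 1)) ≤ 1 → εb * (10 ^ 9 * (F + 1) ^ 2 * (bhi + 4) ^ 3) ≤ 1 →
      10 ^ 3 + 20 * Real.log (bhi + 5) + Real.log (F + 2) ≤ -Real.log εb →
      -- the critical system with memory errors on [0, T]
      n₀ ≤ n → 0 ≤ t₀ → t₀ < T → blo ≤ B → B ≤ bhi →
      (∀ k : ℤ, k < n₀ → ∀ t ∈ Icc 0 T, bv k t = 0 ∧ wv k t = 0 ∧ M0 k t = 0 ∧ M1 k t = 0) →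
      (∀ k : ℤ, ContinuousOn (bv k) (Icc 0 T) ∧ ContinuousOn (wv k) (Icc 0 T) ∧
        ContinuousOn (M0 k) (Icc 0 T) ∧ ContinuousOn (M1 k) (Icc 0 T)) →
      (∀ k : ℤ, ContinuousOn (db k) (Icc 0 T) ∧ ContinuousOn (dw k) (Icc 0 T) ∧
        ∀ t ∈ Ioo 0 T, HasDerivAt (bv k) (db k t) t ∧
          |db k t - R k * (-(bv k t) + G0 k t)| ≤ η * R k * M0 k t ∧
          HasDerivAt (wv k) (dw k t) t ∧ |dw k t - R k * (-(wv k t) + G1 k t)| ≤ η * R k * M1 k t) →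
      (∀ k : ℤ, ∀ t ∈ Icc 0 T, |bv k t| ≤ M0 k t ∧ |wv k t| ≤ M1 k t ∧ 0 ≤ M0 k t ∧ 0 ≤ M1 k t) →
      (∀ k : ℤ, ∀ t₁ ∈ Icc 0 T, ∀ t₂ ∈ Icc t₁ T,
        M0 k t₂ ≤ M0 k t₁ * Real.exp (-(θ * R k * (t₂ - t₁))) +
          R k * ∫ u in t₁..t₂, Real.exp (-(θ * R k * (t₂ - u))) * |G0 k u| ∧
        M1 k t₂ ≤ M1 k t₁ * Real.exp (-(θ * R k * (t₂ - t₁))) +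
          R k * ∫ u in t₁..t₂, Real.exp (-(θ * R k * (t₂ - u))) * |G1 k u|) →
      -- the a-priori far tail above the front, and the hand-off invariant at t₀
      (∃ J : ℕ, ∀ j : ℕ, J ≤ j → ∀ t ∈ Icc 0 T,
        |bv (n + j) t| ≤ lad j ∧ |wv (n + j) t| ≤ lad j / 5 ∧ M0 (n + j) t ≤ lad j ∧ M1 (n + j) t ≤ lad j) →
      Inv n B t₀ →
      (∃ t₁ ∈ Ioo t₀ T, t₁ ≤ t₀ + 4 / R n ∧ ∃ B' : ℝ, Inv (n + 1) B' t₁ ∧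
        q * (B + Real.log εb - 6 * Real.log (B + 2) - 58) ≤ B' ∧
        B' ≤ q * (B + Real.log (10 * (F + 2) * εb * B) + 25) ∧
        (∀ t ∈ Icc t₀ t₁, Tube n t ∧ bv n t ≤ B + 3) ∧
        (∃ tc ∈ Ioo t₀ t₁, (∀ s ∈ Ico t₀ tc, bv (n + 1) s < 1) ∧ bv (n + 1) tc = 1 ∧
          ∃ δ : ℝ, 0 < δ ∧ tc + δ ≤ t₁ ∧ ∀ s ∈ Ioc tc (tc + δ), 1 < bv (n + 1) s)) ∨
      (T < t₀ + 4 / R n ∧ ∀ t ∈ Icc t₀ T, Tube n t ∧ bv n t ≤ B + 3)) →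
      ∀ (A S₀ : ℝ) (Y₀ : Fin 2 → ℤ → ℝ → ℝ) (n : ℤ) (B t₀ : ℝ), Sol A S₀ Y₀ → 0 ≤ n → 0 ≤ t₀ → t₀ < S₀ →
      blo ≤ B → B ≤ bhi → Invo A Y₀ n B t₀ →
      ∃ (S : ℝ) (Y : Fin 2 → ℤ → ℝ → ℝ), Sol A S Y ∧ t₀ < S ∧
        (∀ (i : Fin 2) (m : ℤ), ∀ t ∈ Ico 0 (min S S₀), Y i m t = Y₀ i m t) ∧
        (∃ t₁ ∈ Ioo t₀ S, t₁ ≤ t₀ + 4 / R n ∧ ∃ B' : ℝ, Invo A Y (n + 1) B' t₁ ∧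
          q * (B + Real.log εb - 6 * Real.log (B + 2) - 58) ≤ B' ∧
          B' ≤ q * (B + Real.log (10 * (F + 2) * εb * B) + 25) ∧
          (∀ t ∈ Icc t₀ t₁, Tubeo A Y n t ∧ bvo Y n t ≤ B + 3) ∧
          (∃ tc ∈ Ioo t₀ t₁, (∀ s ∈ Ico t₀ tc, bvo Y (n + 1) s < 1) ∧ bvo Y (n + 1) tc = 1 ∧
            ∃ δ : ℝ, 0 < δ ∧ tc + δ ≤ t₁ ∧ ∀ s ∈ Ioc tc (tc + δ), 1 < bvo Y (n + 1) s)) := by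
  intro ε₀ hε₀ hε₁ 𝒟 r Dc εb α kern bvo wvo M0o M1o q R lad Sol hr hr2 hD hDc hεb hα hkern hbvo hwvo
    hM0o hM1o hq hR hlad hSol F bhi Invo hInvo Tubeo hTubeo θ η blo hθ hη hεb6 hθ1 hθ2 hblo hF hη1
    hεb1 hlog hstep A S₀ Y₀ n B t₀ hY₀ hn ht₀ ht₀S hBlo hBhi hInv₀
  have hε1 : ε₀ ≤ 1 := by linarith
  obtain ⟨hka, hkc⟩ := stepExists_kernel hε₀ hε1 𝒟 hkern
  have hDc0 : 0 < Dc := by rw [hDc]; positivity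
  have hη0 : 0 ≤ η := by rw [hη]; positivity
  have hRn : 0 < R n := by rw [hR]; exact mul_pos hDc0 (zpow_pos (by linarith) _)
  have hTm : t₀ < t₀ + 4 / R n := lt_add_of_pos_right _ (div_pos four_pos hRn)
  have hlogεb : Real.log εb ≤ 0 := Real.log_nonpos hεb.le (hεb6.trans (by norm_num))
  have hbhi3 : 0 ≤ bhi + 3 := by linarith
  -- any two solutions from `A` agree on their common lifespan
  have huniq : ∀ {S₁ S₂ : ℝ} {Y₁ Y₂ : Fin 2 → ℤ → ℝ → ℝ}, Sol A S₁ Y₁ → Sol A S₂ Y₂ →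
      ∀ (i : Fin 2) (m : ℤ), ∀ t ∈ Ico 0 (min S₁ S₂), Y₁ i m t = Y₂ i m t := by
    intro S₁ S₂ Y₁ Y₂ h₁ h₂
    rw [hSol] at h₁ h₂
    exact chain_unique hε₀ α kern hka hkc 0 0 A h₁.2.1 h₁.2.2.1 h₁.2.2.2.1 h₁.2.2.2.2 h₂.2.1
      h₂.2.2.1 h₂.2.2.2.1 h₂.2.2.2.2
  by_contra hcon
  -- Step 1: under `hcon` the one-step theorem, fed along any solution `Y` from `A` living beyond `t₀`
  -- at any horizon `T ∈ (t₀, S)`, always takes its a-priori branch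
  have hwin : ∀ (S : ℝ) (Y : Fin 2 → ℤ → ℝ → ℝ), Sol A S Y → t₀ < S → ∀ T ∈ Ioo t₀ S,
      T < t₀ + 4 / R n ∧ ∀ t ∈ Icc t₀ T, Tubeo A Y n t ∧ bvo Y n t ≤ B + 3 := by
    intro S Y hY hSt T hT
    have hY' := hY
    rw [hSol] at hY'
    obtain ⟨hS, hc, hl, hd, hch⟩ := hY'
    -- the bridge package along `Y` on `[0, T]`
    obtain ⟨h1, h2, ⟨db, dw, h3⟩, h5, h6, h7⟩ := stepExists_critical hε₀ hε1 𝒟 r Dc εb α kern bvo wvo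
      M0o M1o q θ η R lad hr hr2 hD hDc hεb hα hkern hbvo hwvo hM0o hM1o hq hθ hη hR hlad A S Y
      (fun k t => (wvo Y (k - 1) t) ^ 2 / q ^ 3 - (wvo Y k t) ^ 2 - εb * bvo Y k t * wvo Y k t)
      (fun k t => wvo Y k t * (bvo Y k t - bvo Y (k + 1) t / q) + εb * (bvo Y k t) ^ 2)
      hS hc hl hd hch (fun _ _ => rfl) (fun _ _ => rfl) n T hn (ht₀.trans_lt hT.1) hT.2
    -- the invariant at `t₀` transfers from `Y₀` to `Y` (they agree on `[0, t₀]`)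
    have hIt : Invo A Y n B t₀ :=
      stepExists_inv_transfer F εb q bhi lad bvo wvo M0o M1o Invo hInvo ht₀
        (stepExists_obs_congr 𝒟 α bvo wvo M0o M1o hbvo hwvo hM0o hM1o fun i k s hs =>
          huniq hY hY₀ i k s ⟨hs.1, lt_min (hs.2.trans_lt (hT.1.trans hT.2)) (hs.2.trans_lt ht₀S)⟩)
        hInv₀
    rcases hstep ε₀ Dc εb θ η F blo bhi 0 (bvo Y) (wvo Y) (M0o A Y) (M1o A Y) db dw q R lad
        (fun k t => (wvo Y (k - 1) t) ^ 2 / q ^ 3 - (wvo Y k t) ^ 2 - εb * bvo Y k t * wvo Y k t)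
        (fun k t => wvo Y k t * (bvo Y k t - bvo Y (k + 1) t / q) + εb * (bvo Y k t) ^ 2)
        (Invo A Y) (Tubeo A Y) n B t₀ T hq hR hlad (fun _ _ => rfl) (fun _ _ => rfl) (hInvo A Y)
        (hTubeo A Y) hε₀ hε₁ hDc0 hθ1 hθ2 hη0 hεb hεb6 hblo hF hη1 hεb1 hlog hn ht₀ hT.1 hBlo hBhi
        h1 h2 h3 h5 h6 h7 hIt with ⟨t₁, ht₁, hrest⟩ | hbr
    · exact (hcon ⟨S, Y, hY, hSt, huniq hY hY₀, t₁, ⟨ht₁.1, ht₁.2.trans hT.2⟩, hrest⟩).elim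
    · exact hbr
  -- Step 2: hence no solution from `A` lives beyond `t₀ + 4 / R n` ...
  have hlife : ∀ (S : ℝ) (Y : Fin 2 → ℤ → ℝ → ℝ), Sol A S Y → t₀ < S → S ≤ t₀ + 4 / R n := by
    intro S Y hY hSt
    by_contra h
    push Not at h
    exact lt_irrefl _ (hwin S Y hY hSt (t₀ + 4 / R n) ⟨hTm, h⟩).1
  -- ... while every solution extending `Y₀` up to `t₀ + 4 / R n` stays in the tube after `t₀`, so is
  -- a-priori bounded, and the continuation principle yields one living beyond: a contradiction
  have hY₀' := hY₀
  rw [hSol] at hY₀'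
  obtain ⟨hS₀, hc₀, hl₀, hd₀, hch₀⟩ := hY₀'
  obtain ⟨T'', Y'', hT'', hc'', hl'', hd'', hch'', -⟩ := stub_extendOfApriori hε₀ α kern hka hkc 0 0 A
    S₀ (t₀ + 4 / R n) Y₀ hS₀ (hlife S₀ Y₀ hY₀ ht₀S) hc₀ hl₀ hd₀ hch₀
    (fun T Y' hST _ hc' hl' hd' hch' _ => by
      have hY' : Sol A T Y' := (hSol A T Y').2 ⟨hS₀.trans_le hST, hc', hl', hd', hch'⟩
      have ht₀T : t₀ < T := ht₀S.trans_le hST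
      refine stepExists_apriori hε₀ bvo wvo lad hbvo hwvo hεb.le hlad hbhi3 (n := n) hl'
        (hd' t₀ ht₀T) fun t ht => ?_
      have htube := (hTubeo A Y' n t).1 ((hwin T Y' hY' ht₀T ((t + T) / 2)
        ⟨by linarith [ht.1, ht.2], by linarith [ht.2]⟩).2 t ⟨ht.1, by linarith [ht.2]⟩).1
      exact ⟨fun k hk => ⟨(htube.1 k hk).1, (htube.1 k hk).2.1⟩,
        fun j hj => ⟨(htube.2 j hj).1, (htube.2 j hj).2.1⟩⟩)
  have hsol'' : Sol A T'' Y'' := (hSol A T'' Y'').2 ⟨by linarith, hc'', hl'', hd'', hch''⟩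
  exact (not_le.2 hT'') (hlife T'' Y'' hsol'' (hTm.trans hT''))

/-- **Registered marker stub of this file** (`stub_stepExistsMarker`; the registered signature of
`stub_stepExists` exceeds the registry's length bound): the mode heat kernel
`k_{i,n}(τ) = Re⟨e^{τΔ}ψ_{i,n}, ψ_{i,n}⟩` of the chain is bounded by `1` (`stepExists_kernel`).
[cite: Tao2016AveragedNS, §4 p. 22 (4.14)] -/
theorem stub_stepExistsMarker :
    ∀ {ε₀ : ℝ}, 0 < ε₀ → ε₀ ≤ 1 → ∀ (𝒟 : CascadeWaveletData ε₀ 2) (i : Fin 2) (n : ℤ) (τ : ℝ),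
      |(pairing (heat τ (cascadeWavelet ε₀ (𝒟.ψ i) n)) (cascadeWavelet ε₀ (𝒟.ψ i) n)).re| ≤ 1 :=
  fun {ε₀} hε₀ hε₁ 𝒟 i n τ => (stepExists_kernel hε₀ hε₁ 𝒟 (kern := fun i n τ =>
    (pairing (heat τ (cascadeWavelet ε₀ (𝒟.ψ i) n)) (cascadeWavelet ε₀ (𝒟.ψ i) n)).re)
    (fun _ _ _ => rfl)).1 i n τ

end Summit.NavierStokesRegularity.NavierStokesRegularity.Theorems.PerpetualPumpAveragedTypeIBlowup

end
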